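import Literature.NumberTheory.Automorphic.JPSSGlobalIntegral
import Literature.NumberTheory.Automorphic.GLnZetaKernel
import Literature.MeasureTheory.Group.InvariantQuotientUnfoldingBochner
import Literature.MeasureTheory.Group.CoveringWeights
import HarnessLib

/-!
# The `GL_n × GL_m` integral `I(s; φ, φ')` unfolded from the automorphic quotient to the group:
`I(s; φ, φ') = C ∫_{GL_m(𝔸_K)} φ(diag(g, 1)) φ'(g) |det g|^{s-1/2} β_{GL_m(K)}(g) dg`
(Cogdell (2004), §2.2: the integral over `GL_m(K)\GL_m(𝔸)`; Getz–Hahn (2024), Thm. 3.2.2, Lemma 9.2.4)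

Topic `NumberTheory/Automorphic`; namespace `Literature.NumberTheory.Automorphic`. Proof file
(theorems only). A brick of the inline decomposition of the named fact
`MoeglinWaldspurger1989_partialPairL_entire_of_rank_ne` along the road of
Jacquet–Piatetski-Shapiro–Shalika (Cogdell (2004), Thm. 2.1): the first step of the unfolding of
the global integral `I(s; φ, φ') = ∫_{GL_m(K)\GL_m(𝔸)} φ(diag(h,1)) φ'(h) |det h|^{s-1/2} dh`
(`jpssIntegral`, `JPSSGlobalIntegral`, written on the tree's finite-volume quotient
`X_m = GL_m(𝔸_K) ⧸ A_G GL_m(K)` with the `A_G`-fibre integrated first) — its expression as an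
integral over the GROUP `GL_m(𝔸_K)` against a Haar measure and a `GL_m(K)`-covering weight `β`
(`Σ_{γ ∈ GL_m(K)} β(γ g) = 1`, `IsCoveringWeight`), the currency in which the tree unfolds automorphic
integrals (`RankinSelbergQuotientUnfolding`, `WhittakerTowerParseval`, `CoveringWeightsBochner`):

* `tsum_coveringWeight_inv_mul` — `Σ_γ β(γ⁻¹ g) = 1` (in `[0, ∞]` and in `ℝ`);
* `tsum_fibre_integrand_eq` — the sum over `GL_m(K)` of Weil's integrand along a fibre collapses
  the covering weight;
* `integral_center'_fibre_eq_mul_jpssKernel` — the `A_G`-integral along a fibre is the fibre integral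
  `jpssKernel` (`A_G ≅ ℝ` through `centerLog`, `GLnZetaKernel`; the coordinate `u` of `jpssKernel` is
  `v / (m [K:ℚ])`);
* `fiberLIntegral_radial_mul_coveringWeight_le`, `integrable_fibre_integrand` — absolute convergence
  on the group, for every `s`, from the uniform decay estimate `exists_bound_corner_mul`
  (`CuspFormCornerDecay`) and the finite volume of `X_m`;
* `exists_jpssIntegral_eq_mul_integral_coveringWeight` (**main**) — for `0 < m < n`, an automorphic
  measure `μ'` on `X_m` and a Haar measure `ν` on `GL_m(𝔸_K)` there is `C > 0` such that for all
  continuous `φ`, `φ'` with rapidly decreasing classical functions `Φ = invQuot φ`,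
  `Φ' = invQuot φ'`, every `GL_m(K)`-covering weight `β` and every `s ∈ ℂ`,

    `jpssIntegral hmn μ' φ φ' s = C ∫_{GL_m(𝔸_K)} Φ(diag(g,1)) Φ'(g) |det g|_𝔸^{s-1/2} β(g) dν(g)`,

  the right side converging absolutely.

Proof: Weil's formula for `X_m = G ⧸ H`, `H = A_G GL_m(K)`, in Bochner form
(`integral_fiberIntegralE_eq_mul_integral`, `InvariantQuotientUnfoldingBochner`) applied to
`f(y) = Φ(diag(y⁻¹,1)) |det y⁻¹|^{s-1/2} β(y⁻¹) Φ'(y⁻¹)`: the fibre integral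
`∫_H f(g h) dρ_H = κ ∫_{A_G} Σ_γ f(g a γ) dα` (`integral_quotientSubgroup_eq_smul_integral_tsum`,
`GLnZetaKernel`) collapses the covering weight (`Σ_γ β(γ⁻¹ y) = 1`, invariance of `Φ ∘ diag(·,1)`,
`|det|` and `Φ'` under `GL_m(K)`, of `Φ'` under `A_G`) and the `A_G`-integral is `φ' · jpssKernel`
(`integral_comp_centerLog_eq_smul`), so that `fiberIntegralE f = κ c m[K:ℚ] · φ' · jpssFibre` on
`X_m`; on the group side `y ↦ y⁻¹` preserves the Haar measure of the unimodular `GL_m(𝔸_K)`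
(`isInvInvariant_of_isHaarMeasure_gl`).

## References

* J. W. Cogdell, *Analytic theory of L-functions for GL_n*, in J. Bernstein, S. Gelbart (eds.),
  *An Introduction to the Langlands Program* (2004), §2.2 (PDF pp. 181–184 of the held copy)
  [CogdellAnalyticTheory2004].
* J. R. Getz, H. Hahn, *An Introduction to Automorphic Representations*, GTM 300 (2024), Thm. 3.2.2,
  Lemma 9.2.4 [GetzHahn2024].
-/

noncomputable section

open MeasureTheory Measure Set Filter Topology IsDedekindDomain NumberField
open Literature.MeasureTheory.Group
open scoped ENNReal NNReal MatrixGroups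

namespace Literature.NumberTheory.Automorphic

-- the quotient carries the tree's Borel σ-algebra, not Mathlib's quotient σ-algebra
attribute [-instance] Quotient.instMeasurableSpace QuotientGroup.measurableSpace

attribute [local instance] adelicBorel borelSpace_adelic locallyCompactSpace_adelic
  secondCountableTopology_gl_adelic

/-! ### The split centre in the coordinates `v = log |det a|_𝔸` and `u = v / (m[K:ℚ])` -/

section Center

variable {m : ℕ} {K : Type} [Field K] [NumberField K]

/-- `z(e^u)⁻¹ = z(e^{-u})`. [folklore] -/
theorem scalarExp_inv (u : ℝ) : (scalarExp m K u)⁻¹ = scalarExp m K (-u) :=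
  inv_eq_of_mul_eq_one_right (by rw [← scalarExp_add, add_neg_cancel, scalarExp_zero])

/-- The inverse of `centerLog` is `v ↦ z(e^{v/(m[K:ℚ])})` (definitional). [folklore] -/
theorem coe_centerLog_symm (hm : 0 < m) (v : ℝ) :
    (((centerLog m K hm).symm v : ↥(AdelicGroupData.gl m K).center') : (AdelicGroupData.gl m K).Adelic) =
      scalarExp m K (v / (m * Module.finrank ℚ K : ℕ)) := rfl

/-- **Integration over `A_G` in the coordinate `u` of `jpssKernel`.** For a Haar measure `α` on `A_G`
with `centerLog_* α = c · dv` and `G : A_G → ℂ`: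
`∫_{A_G} G dα = c · m[K:ℚ] · ∫_ℝ G(z(e^u)) du` (the substitution `v = m[K:ℚ] u` after
`integral_comp_centerLog_eq_smul`). [folklore] -/
theorem integral_center'_eq_mul_integral_scalarExp (hm : 0 < m)
    {α : Measure ↥(AdelicGroupData.gl m K).center'} {c : ℝ≥0}
    (hα : α.map (centerLog m K hm) = c • (volume : Measure ℝ))
    (G : ↥(AdelicGroupData.gl m K).center' → ℂ) :
    ∫ a, G a ∂α = ((c : ℝ) * (m * Module.finrank ℚ K : ℕ) : ℂ) *
      ∫ u : ℝ, G ⟨scalarExp m K u, ⟨expUnitNNReal u, rfl⟩⟩ := by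
  set L := centerLog m K hm with hL
  set D : ℕ := m * Module.finrank ℚ K with hD
  have hD0 : (0 : ℝ) < D := by exact_mod_cast Nat.mul_pos hm Module.finrank_pos
  have h1 : (fun a => G a) = fun a => (G ∘ L.symm) (L a) := by
    funext a; simp only [Function.comp_apply, Homeomorph.symm_apply_apply]
  rw [h1, integral_comp_centerLog_eq_smul hm hα (G ∘ L.symm)]
  have h2 : ∀ v : ℝ, (G ∘ L.symm) v = (fun u : ℝ => G ⟨scalarExp m K u, ⟨expUnitNNReal u, rfl⟩⟩) (v / D) := by
    intro v
    rfl
  simp_rw [h2]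
  rw [Measure.integral_comp_div (fun u : ℝ => G ⟨scalarExp m K u, ⟨expUnitNNReal u, rfl⟩⟩) (D : ℝ),
    abs_of_pos hD0, Complex.real_smul, Complex.real_smul, ← mul_assoc]
  push_cast
  ring

end Center

/-! ### The collapse of the covering weight along the fibres -/

section Collapse

variable {n m : ℕ} {K : Type} [Field K] [NumberField K]

/-- **Collapse of a covering weight along `GL_m(K)`**: for a `GL_m(K)`-covering weight `β` on
`GL_m(𝔸_K)` (`Σ_γ β(γ g) = 1`), also `Σ_γ β(γ⁻¹ g) = 1` (reindex by `γ ↦ γ⁻¹`), in `[0, ∞]` and,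
term by term finite (`β ≤ 1`), in `ℝ`. [folklore] -/
theorem tsum_coveringWeight_inv_mul {β : (AdelicGroupData.gl m K).Adelic → ℝ≥0∞}
    (hβ : IsCoveringWeight ↥(AdelicGroupData.gl m K).arithmeticSubgroup β)
    (y : (AdelicGroupData.gl m K).Adelic) :
    ∑' γ : ↥(AdelicGroupData.gl m K).arithmeticSubgroup,
        β (((γ : (AdelicGroupData.gl m K).Adelic))⁻¹ * y) = 1 ∧
      ∑' γ : ↥(AdelicGroupData.gl m K).arithmeticSubgroup,
        (β (((γ : (AdelicGroupData.gl m K).Adelic))⁻¹ * y)).toReal = 1 := by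
  have h1 : ∑' γ : ↥(AdelicGroupData.gl m K).arithmeticSubgroup,
      β (((γ : (AdelicGroupData.gl m K).Adelic))⁻¹ * y) = 1 := by
    have h := hβ.coveringSum_eq y
    rw [coveringSum_apply] at h
    rw [← h, ← (Equiv.inv ↥(AdelicGroupData.gl m K).arithmeticSubgroup).tsum_eq
      (fun γ : ↥(AdelicGroupData.gl m K).arithmeticSubgroup => β (γ • y))]
    refine tsum_congr fun γ => ?_
    rw [Equiv.inv_apply, Subgroup.smul_def, smul_eq_mul, Subgroup.coe_inv]
  refine ⟨h1, ?_⟩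
  rw [← ENNReal.tsum_toReal_eq (fun γ => ne_top_of_le_ne_top ENNReal.one_ne_top (hβ.le_one _)), h1,
    ENNReal.toReal_one]

/-- **The sum over `GL_m(K)` of the integrand along a fibre.** For `Φ = invQuot φ` on `GL_n`,
`Φ' = invQuot φ'` on `GL_m`, a `GL_m(K)`-covering weight `β`, `g ∈ GL_m(𝔸_K)` and `a ∈ A_G`:
`Σ_{γ ∈ GL_m(K)} f(g a γ) = Φ'(g⁻¹) · q_s(a⁻¹ g⁻¹)` for
`f(y) = q_s(y⁻¹) β(y⁻¹) Φ'(y⁻¹)`, `q_s(y) = Φ(diag(y,1)) |det y|^{s-1/2}` — left invariance of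
`Φ ∘ diag(·,1)`, `|det|` and `Φ'` under `GL_m(K)`, invariance of `Φ'` under `A_G`, and the collapse
`Σ_γ β(γ⁻¹ y) = 1`. [folklore] -/
theorem tsum_fibre_integrand_eq (hmn : m < n) (φ : (AdelicGroupData.gl n K).automorphicQuotient → ℂ)
    (φ' : (AdelicGroupData.gl m K).automorphicQuotient → ℂ)
    {β : (AdelicGroupData.gl m K).Adelic → ℝ≥0∞}
    (hβ : IsCoveringWeight ↥(AdelicGroupData.gl m K).arithmeticSubgroup β) (s : ℂ)
    (g : (AdelicGroupData.gl m K).Adelic) (a : ↥(AdelicGroupData.gl m K).center') :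
    ∑' γ : ↥(AdelicGroupData.gl m K).arithmeticSubgroup,
      (invQuot (AdelicGroupData.gl n K) φ (glCorner (AdeleRing (𝓞 K) K) hmn.le
          ((g * ((a : (AdelicGroupData.gl m K).Adelic) * (γ : (AdelicGroupData.gl m K).Adelic)))⁻¹ :
            (AdelicGroupData.gl m K).Adelic)) *
        ((((glAbsDet m K ((g * ((a : (AdelicGroupData.gl m K).Adelic) *
            (γ : (AdelicGroupData.gl m K).Adelic)))⁻¹ : (AdelicGroupData.gl m K).Adelic) : ℝ≥0ˣ) : ℝ≥0) : ℝ) : ℂ) ^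
          (s - 1 / 2) *
        ((β (g * ((a : (AdelicGroupData.gl m K).Adelic) * (γ : (AdelicGroupData.gl m K).Adelic)))⁻¹).toReal : ℂ) *
        invQuot (AdelicGroupData.gl m K) φ'
          (g * ((a : (AdelicGroupData.gl m K).Adelic) * (γ : (AdelicGroupData.gl m K).Adelic)))⁻¹) =
      invQuot (AdelicGroupData.gl m K) φ' g⁻¹ *
        (invQuot (AdelicGroupData.gl n K) φ (glCorner (AdeleRing (𝓞 K) K) hmn.le
            (((a : (AdelicGroupData.gl m K).Adelic))⁻¹ * g⁻¹)) *
          ((((glAbsDet m K (((a : (AdelicGroupData.gl m K).Adelic))⁻¹ * g⁻¹) : ℝ≥0ˣ) : ℝ≥0) : ℝ) : ℂ) ^ (s - 1 / 2)) := by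
  set Φ : (AdelicGroupData.gl n K).Adelic → ℂ := invQuot (AdelicGroupData.gl n K) φ with hΦ
  set Φ' : (AdelicGroupData.gl m K).Adelic → ℂ := invQuot (AdelicGroupData.gl m K) φ' with hΦ'
  set y : (AdelicGroupData.gl m K).Adelic := ((a : (AdelicGroupData.gl m K).Adelic))⁻¹ * g⁻¹ with hy
  -- GL-typed copies for the monoid homomorphisms `glCorner`, `glAbsDet`
  have hK : ∀ γ ∈ rationalPointsGL n K, ∀ x : GL (Fin n) (AdeleRing (𝓞 K) K), Φ (γ * x) = Φ x :=
    fun γ hγ x => isLeftInvariant_invQuot _ φ γ hγ x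
  have hK' : ∀ γ ∈ rationalPointsGL m K, ∀ x : GL (Fin m) (AdeleRing (𝓞 K) K), Φ' (γ * x) = Φ' x :=
    fun γ hγ x => isLeftInvariant_invQuot _ φ' γ hγ x
  have hZ' : ∀ z ∈ (posRealScalar m K).range, ∀ x : GL (Fin m) (AdeleRing (𝓞 K) K), Φ' (z * x) = Φ' x :=
    fun z hz x => invQuot_mul_left _ φ' (Subgroup.mem_sup_left hz) x
  -- the term at `γ`
  have hterm : ∀ γ : ↥(AdelicGroupData.gl m K).arithmeticSubgroup,
      Φ (glCorner (AdeleRing (𝓞 K) K) hmn.le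
          ((g * ((a : (AdelicGroupData.gl m K).Adelic) * (γ : (AdelicGroupData.gl m K).Adelic)))⁻¹ :
            (AdelicGroupData.gl m K).Adelic)) *
        ((((glAbsDet m K ((g * ((a : (AdelicGroupData.gl m K).Adelic) *
            (γ : (AdelicGroupData.gl m K).Adelic)))⁻¹ : (AdelicGroupData.gl m K).Adelic) : ℝ≥0ˣ) : ℝ≥0) : ℝ) : ℂ) ^
          (s - 1 / 2) *
        ((β (g * ((a : (AdelicGroupData.gl m K).Adelic) * (γ : (AdelicGroupData.gl m K).Adelic)))⁻¹).toReal : ℂ) *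
        Φ' (g * ((a : (AdelicGroupData.gl m K).Adelic) * (γ : (AdelicGroupData.gl m K).Adelic)))⁻¹ =
      (Φ' g⁻¹ * (Φ (glCorner (AdeleRing (𝓞 K) K) hmn.le y) *
        ((((glAbsDet m K y : ℝ≥0ˣ) : ℝ≥0) : ℝ) : ℂ) ^ (s - 1 / 2))) *
        ((β (((γ : (AdelicGroupData.gl m K).Adelic))⁻¹ * y)).toReal : ℂ) := by
    intro γ
    have hγ : (γ : (AdelicGroupData.gl m K).Adelic) ∈ rationalPointsGL m K := γ.2
    have hinv : ((g * ((a : (AdelicGroupData.gl m K).Adelic) * (γ : (AdelicGroupData.gl m K).Adelic)))⁻¹ :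
        (AdelicGroupData.gl m K).Adelic) = ((γ : (AdelicGroupData.gl m K).Adelic))⁻¹ * y := by
      rw [hy, mul_inv_rev, mul_inv_rev, mul_assoc]
    rw [hinv]
    -- pass to the `GL` spelling for the homomorphisms
    set γ' : GL (Fin m) (AdeleRing (𝓞 K) K) := ((γ : (AdelicGroupData.gl m K).Adelic))⁻¹ with hγ'
    set y' : GL (Fin m) (AdeleRing (𝓞 K) K) := y with hy'
    have hγ'm : γ' ∈ rationalPointsGL m K := Subgroup.inv_mem _ hγ
    have h1 : Φ (glCorner (AdeleRing (𝓞 K) K) hmn.le (γ' * y')) = Φ (glCorner (AdeleRing (𝓞 K) K) hmn.le y') := by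
      rw [map_mul]
      exact hK _ (glCorner_mem_rationalPointsGL hmn.le hγ'm) _
    have h2 : glAbsDet m K (γ' * y') = glAbsDet m K y' := by
      rw [map_mul, glAbsDet_eq_one_of_mem_rationalPointsGL hγ'm, one_mul]
    have h3 : Φ' (γ' * y') = Φ' g⁻¹ := by
      rw [hK' _ hγ'm]
      set a' : GL (Fin m) (AdeleRing (𝓞 K) K) := ((a : (AdelicGroupData.gl m K).Adelic)) with ha'
      set g' : GL (Fin m) (AdeleRing (𝓞 K) K) := g with hg'
      change Φ' (a'⁻¹ * g'⁻¹) = Φ' g'⁻¹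
      exact hZ' _ (Subgroup.inv_mem _ a.2) _
    change Φ (glCorner (AdeleRing (𝓞 K) K) hmn.le (γ' * y')) *
        ((((glAbsDet m K (γ' * y') : ℝ≥0ˣ) : ℝ≥0) : ℝ) : ℂ) ^ (s - 1 / 2) *
        ((β (((γ : (AdelicGroupData.gl m K).Adelic))⁻¹ * y)).toReal : ℂ) * Φ' (γ' * y') = _
    rw [h1, h2, h3]
    ring
  simp_rw [hterm]
  rw [tsum_mul_left, ← Complex.ofReal_tsum, (tsum_coveringWeight_inv_mul hβ y).2, Complex.ofReal_one,
    mul_one]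

/-- **The `A_G`-integral along a fibre is the fibre integral `jpssKernel`**:
`∫_{A_G} q_s(a⁻¹ g⁻¹) dα(a) = c · m[K:ℚ] · jpssKernel φ s g⁻¹` (`centerLog_* α = c · dv`; in the
coordinate `u`, `z(e^u)⁻¹ = z(e^{-u})` and `u ↦ -u` preserves `du`). [folklore] -/
theorem integral_center'_fibre_eq_mul_jpssKernel (hm : 0 < m) (hmn : m < n)
    (φ : (AdelicGroupData.gl n K).automorphicQuotient → ℂ)
    {α : Measure ↥(AdelicGroupData.gl m K).center'} {c : ℝ≥0}
    (hα : α.map (centerLog m K hm) = c • (volume : Measure ℝ))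
    (s : ℂ) (g : (AdelicGroupData.gl m K).Adelic) :
    ∫ a : ↥(AdelicGroupData.gl m K).center',
        invQuot (AdelicGroupData.gl n K) φ (glCorner (AdeleRing (𝓞 K) K) hmn.le
            (((a : (AdelicGroupData.gl m K).Adelic))⁻¹ * g⁻¹)) *
          ((((glAbsDet m K (((a : (AdelicGroupData.gl m K).Adelic))⁻¹ * g⁻¹) : ℝ≥0ˣ) : ℝ≥0) : ℝ) : ℂ) ^ (s - 1 / 2) ∂α =
      ((c : ℝ) * (m * Module.finrank ℚ K : ℕ) : ℂ) * jpssKernel hmn φ s g⁻¹ := by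
  rw [integral_center'_eq_mul_integral_scalarExp hm hα]
  congr 1
  -- pass to the `GL` spelling of `jpssKernel`
  set g' : GL (Fin m) (AdeleRing (𝓞 K) K) := g⁻¹ with hg'
  set G' : ℝ → ℂ := fun u : ℝ => invQuot (AdelicGroupData.gl n K) φ
      (glCorner (AdeleRing (𝓞 K) K) hmn.le (scalarExp m K u * g')) *
    ((((glAbsDet m K (scalarExp m K u * g') : ℝ≥0ˣ) : ℝ≥0) : ℝ) : ℂ) ^ (s - 1 / 2) with hG'
  have h1 : ∀ u : ℝ, (((⟨scalarExp m K u, ⟨expUnitNNReal u, rfl⟩⟩ :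
      ↥(AdelicGroupData.gl m K).center') : (AdelicGroupData.gl m K).Adelic))⁻¹ * g⁻¹ =
      (show (AdelicGroupData.gl m K).Adelic from scalarExp m K (-u) * g') := fun u => by
    change (scalarExp m K u)⁻¹ * g' = scalarExp m K (-u) * g'
    rw [scalarExp_inv]
  simp_rw [h1]
  change ∫ u : ℝ, G' (-u) = ∫ u : ℝ, G' u
  exact integral_neg_eq_self G' volume

end Collapse

/-! ### Absolute convergence on the group -/

section Integrable

variable {n m : ℕ} {K : Type} [Field K] [NumberField K]

/-- `min(t^B, t^{-B}) t^{σ'} ≤ e^{-|w|}` for `t = e^w` and `B = |σ'| + 1`. [folklore] -/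
theorem min_rpow_mul_rpow_exp_le {σ' w : ℝ} :
    min (Real.exp w ^ (|σ'| + 1)) (Real.exp w ^ (-(|σ'| + 1))) * Real.exp w ^ σ' ≤ Real.exp (-|w|) := by
  rw [min_exp_mul_exp_neg_mul (by positivity : (0 : ℝ) ≤ |σ'| + 1), ← Real.exp_mul, ← Real.exp_add]
  refine Real.exp_le_exp.2 ?_
  have h : w * σ' ≤ |w| * |σ'| := by
    calc w * σ' ≤ |w * σ'| := le_abs_self _
      _ = |w| * |σ'| := abs_mul _ _
  nlinarith [abs_nonneg w, abs_nonneg σ']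

/-- The integrand of `I(s; φ, φ')` on the group (Weil's `f`) is Borel. [folklore] -/
theorem measurable_fibre_integrand (hmn : m < n)
    {φ : (AdelicGroupData.gl n K).automorphicQuotient → ℂ}
    (hφc : Continuous (invQuot (AdelicGroupData.gl n K) φ))
    {φ' : (AdelicGroupData.gl m K).automorphicQuotient → ℂ}
    (hφ'c : Continuous (invQuot (AdelicGroupData.gl m K) φ'))
    {β : (AdelicGroupData.gl m K).Adelic → ℝ≥0∞} (hβm : Measurable β) (s : ℂ) :
    Measurable fun y : (AdelicGroupData.gl m K).Adelic =>
      invQuot (AdelicGroupData.gl n K) φ (glCorner (AdeleRing (𝓞 K) K) hmn.le (y⁻¹ : (AdelicGroupData.gl m K).Adelic)) *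
        ((((glAbsDet m K (y⁻¹ : (AdelicGroupData.gl m K).Adelic) : ℝ≥0ˣ) : ℝ≥0) : ℝ) : ℂ) ^ (s - 1 / 2) *
        ((β y⁻¹).toReal : ℂ) * invQuot (AdelicGroupData.gl m K) φ' y⁻¹ := by
  have hN : Continuous fun y : (AdelicGroupData.gl m K).Adelic => (((glAbsDet m K y : ℝ≥0ˣ) : ℝ≥0) : ℝ) :=
    continuous_glAbsDet_real m K
  have hc : Continuous fun y : (AdelicGroupData.gl m K).Adelic =>
      invQuot (AdelicGroupData.gl n K) φ (glCorner (AdeleRing (𝓞 K) K) hmn.le y) :=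
    hφc.comp (continuous_glCorner hmn.le)
  have hq : Continuous fun y : (AdelicGroupData.gl m K).Adelic =>
      invQuot (AdelicGroupData.gl n K) φ (glCorner (AdeleRing (𝓞 K) K) hmn.le y) *
        ((((glAbsDet m K y : ℝ≥0ˣ) : ℝ≥0) : ℝ) : ℂ) ^ (s - 1 / 2) := by
    refine hc.mul ?_
    refine Continuous.cpow (Complex.continuous_ofReal.comp hN) continuous_const
      fun y => Complex.ofReal_mem_slitPlane.2 (glAbsDet_real_pos _)
  have h1 : Measurable fun y : (AdelicGroupData.gl m K).Adelic =>
      invQuot (AdelicGroupData.gl n K) φ (glCorner (AdeleRing (𝓞 K) K) hmn.le (y⁻¹ : (AdelicGroupData.gl m K).Adelic)) *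
        ((((glAbsDet m K (y⁻¹ : (AdelicGroupData.gl m K).Adelic) : ℝ≥0ˣ) : ℝ≥0) : ℝ) : ℂ) ^ (s - 1 / 2) :=
    (hq.comp continuous_inv).measurable
  have h2 : Measurable fun y : (AdelicGroupData.gl m K).Adelic => ((β y⁻¹).toReal : ℂ) :=
    Complex.measurable_ofReal.comp ((hβm.comp measurable_inv).ennreal_toReal)
  have h3 : Measurable fun y : (AdelicGroupData.gl m K).Adelic => invQuot (AdelicGroupData.gl m K) φ' y⁻¹ :=
    (hφ'c.comp continuous_inv).measurable
  exact (h1.mul h2).mul h3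

/-- **The fibre integrals of the radial majorant are uniformly bounded.** For
`R(g) = ofReal (min(|det g|^B, |det g|^{-B}) |det g|^{σ'})`, `B = |σ'| + 1`, a `GL_m(K)`-covering
weight `β`, Haar measures `ρ` of `H = A_G GL_m(K)` and `α` of `A_G` with `ρ = κ (α ⊗ count)` along
`quotientSubgroupEquiv` and `centerLog_* α = c · dv`: the fibre integral of `y ↦ R(y⁻¹) β(y⁻¹)` over
every coset is at most `κ c ∫ e^{-|v|} dv` (collapse of `β`, `|det (a⁻¹ g⁻¹)| = e^{-v} |det g⁻¹|` for
`v = log |det a|`, and translation and reflection invariance of `dv`). [folklore] -/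
theorem fiberLIntegral_radial_mul_coveringWeight_le (hm : 0 < m)
    {β : (AdelicGroupData.gl m K).Adelic → ℝ≥0∞}
    (hβ : IsCoveringWeight ↥(AdelicGroupData.gl m K).arithmeticSubgroup β)
    {ρ : Measure ↥(AdelicGroupData.gl m K).quotientSubgroup} [ρ.IsHaarMeasure]
    {α : Measure ↥(AdelicGroupData.gl m K).center'} [α.IsHaarMeasure] {κ c : ℝ≥0}
    (hκ : ρ.map (quotientSubgroupEquiv m K) =
      κ • α.prod (count : Measure ↥(AdelicGroupData.gl m K).arithmeticSubgroup))
    (hα : α.map (centerLog m K hm) = c • (volume : Measure ℝ))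
    (σ' : ℝ) (g : (AdelicGroupData.gl m K).Adelic) :
    ∫⁻ h : ↥(AdelicGroupData.gl m K).quotientSubgroup,
        ENNReal.ofReal (min
            ((((glAbsDet m K ((g * (h : (AdelicGroupData.gl m K).Adelic))⁻¹ : (AdelicGroupData.gl m K).Adelic) :
              ℝ≥0ˣ) : ℝ≥0) : ℝ) ^ (|σ'| + 1))
            ((((glAbsDet m K ((g * (h : (AdelicGroupData.gl m K).Adelic))⁻¹ : (AdelicGroupData.gl m K).Adelic) :
              ℝ≥0ˣ) : ℝ≥0) : ℝ) ^ (-(|σ'| + 1))) *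
          (((glAbsDet m K ((g * (h : (AdelicGroupData.gl m K).Adelic))⁻¹ : (AdelicGroupData.gl m K).Adelic) :
            ℝ≥0ˣ) : ℝ≥0) : ℝ) ^ σ') *
        β (g * (h : (AdelicGroupData.gl m K).Adelic))⁻¹ ∂ρ ≤
      κ * (c * ∫⁻ v : ℝ, ENNReal.ofReal (Real.exp (-|v|))) := by
  haveI : BorelSpace ↥(AdelicGroupData.gl m K).arithmeticSubgroup := Subtype.borelSpace _
  haveI : BorelSpace (↥(AdelicGroupData.gl m K).center' × ↥(AdelicGroupData.gl m K).arithmeticSubgroup) :=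
    Prod.borelSpace
  set B : ℝ := |σ'| + 1 with hB
  set r : ℝ → ℝ := fun t => min (t ^ B) (t ^ (-B)) * t ^ σ' with hr
  set R : (AdelicGroupData.gl m K).Adelic → ℝ≥0∞ := fun y =>
    ENNReal.ofReal (r (((glAbsDet m K y : ℝ≥0ˣ) : ℝ≥0) : ℝ)) with hR
  have hNc : Continuous fun y : (AdelicGroupData.gl m K).Adelic => (((glAbsDet m K y : ℝ≥0ˣ) : ℝ≥0) : ℝ) :=
    continuous_glAbsDet_real m K
  have hNm : Measurable fun y : (AdelicGroupData.gl m K).Adelic => (((glAbsDet m K y : ℝ≥0ˣ) : ℝ≥0) : ℝ) :=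
    hNc.measurable
  have hrm : Measurable r :=
    (Measurable.min (measurable_id.pow_const _) (measurable_id.pow_const _)).mul (measurable_id.pow_const _)
  have hRm : Measurable R := ENNReal.measurable_ofReal.comp (hrm.comp hNm)
  -- the integrand as a function on `H`
  set e := quotientSubgroupEquiv m K with he
  set em : ↥(AdelicGroupData.gl m K).quotientSubgroup ≃ᵐ
      ↥(AdelicGroupData.gl m K).center' × ↥(AdelicGroupData.gl m K).arithmeticSubgroup :=
    e.toHomeomorph.toMeasurableEquiv with hem
  have hem' : (em : _ → _) = e := rfl
  set F : ↥(AdelicGroupData.gl m K).quotientSubgroup → ℝ≥0∞ := fun h =>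
    R ((g * (h : (AdelicGroupData.gl m K).Adelic))⁻¹ : (AdelicGroupData.gl m K).Adelic) *
      β (g * (h : (AdelicGroupData.gl m K).Adelic))⁻¹ with hF
  have h1m : Measurable fun h : ↥(AdelicGroupData.gl m K).quotientSubgroup =>
      (g * (h : (AdelicGroupData.gl m K).Adelic))⁻¹ :=
    ((measurable_const_mul g).comp measurable_subtype_coe).inv
  have hFm : Measurable F := (hRm.comp h1m).mul (hβ.measurable.comp h1m)
  change ∫⁻ h, F h ∂ρ ≤ _
  -- transport along `e`: `∫⁻ F dρ = κ ∫⁻ a Σ' γ F(e.symm(a,γ)) dα`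
  have hI : ∫⁻ h, F h ∂ρ = κ * ∫⁻ a, ∑' γ : ↥(AdelicGroupData.gl m K).arithmeticSubgroup,
      F (e.symm (a, γ)) ∂α := by
    have hFem : Measurable fun p => F (e.symm p) := hFm.comp e.symm.continuous.measurable
    have h1 : ∫⁻ p, F (e.symm p) ∂(ρ.map em) = ∫⁻ h, F h ∂ρ := by
      rw [lintegral_map_equiv]
      refine lintegral_congr fun h => ?_
      rw [hem', ContinuousMulEquiv.symm_apply_apply]
    rw [← h1, show ρ.map em = ρ.map e from rfl, hκ, lintegral_smul_measure, lintegral_prod _ hFem.aemeasurable,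
      ENNReal.smul_def, smul_eq_mul]
    congr 1
    refine lintegral_congr fun a => ?_
    rw [lintegral_count]
  rw [hI]
  -- collapse of the covering weight along `GL_m(K)`
  have hcollapse : ∀ a : ↥(AdelicGroupData.gl m K).center',
      ∑' γ : ↥(AdelicGroupData.gl m K).arithmeticSubgroup, F (e.symm (a, γ)) =
        R (((a : (AdelicGroupData.gl m K).Adelic))⁻¹ * g⁻¹) := by
    intro a
    set y : (AdelicGroupData.gl m K).Adelic := ((a : (AdelicGroupData.gl m K).Adelic))⁻¹ * g⁻¹ with hy
    have hterm : ∀ γ : ↥(AdelicGroupData.gl m K).arithmeticSubgroup,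
        F (e.symm (a, γ)) = R y * β (((γ : (AdelicGroupData.gl m K).Adelic))⁻¹ * y) := by
      intro γ
      simp only [hF, he, coe_quotientSubgroupEquiv_symm_apply]
      have hinv : ((g * ((a : (AdelicGroupData.gl m K).Adelic) * (γ : (AdelicGroupData.gl m K).Adelic)))⁻¹ :
          (AdelicGroupData.gl m K).Adelic) = ((γ : (AdelicGroupData.gl m K).Adelic))⁻¹ * y := by
        rw [hy, mul_inv_rev, mul_inv_rev, mul_assoc]
      rw [hinv]
      have hγ : (γ : (AdelicGroupData.gl m K).Adelic) ∈ rationalPointsGL m K := γ.2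
      set γ' : GL (Fin m) (AdeleRing (𝓞 K) K) := ((γ : (AdelicGroupData.gl m K).Adelic))⁻¹ with hγ'
      set y' : GL (Fin m) (AdeleRing (𝓞 K) K) := y with hy'
      have h2 : glAbsDet m K (γ' * y') = glAbsDet m K y' := by
        rw [map_mul, glAbsDet_eq_one_of_mem_rationalPointsGL (Subgroup.inv_mem _ hγ), one_mul]
      change R (γ' * y') * β (γ' * y') = R y' * β (γ' * y')
      simp only [hR, h2]
    simp_rw [hterm]
    rw [ENNReal.tsum_mul_left, (tsum_coveringWeight_inv_mul hβ y).1, mul_one]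
  simp_rw [hcollapse]
  -- the `A_G`-integral in the coordinate `v = log |det a|`: `|det (a⁻¹ g⁻¹)| = e^{-v} |det g⁻¹|`
  set N₀ : ℝ := (((glAbsDet m K g⁻¹ : ℝ≥0ˣ) : ℝ≥0) : ℝ) with hN₀
  have hN₀0 : 0 < N₀ := glAbsDet_real_pos _
  set L : ℝ := Real.log N₀ with hL
  set q : ℝ → ℝ≥0∞ := fun w : ℝ => ENNReal.ofReal (Real.exp (-|w|)) with hq
  have hqm : Measurable q := ENNReal.measurable_ofReal.comp (Real.continuous_exp.comp continuous_abs.neg).measurable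
  have hpt : ∀ a : ↥(AdelicGroupData.gl m K).center',
      R (((a : (AdelicGroupData.gl m K).Adelic))⁻¹ * g⁻¹) ≤ (fun v : ℝ => q (-v + L)) (centerLog m K hm a) := by
    intro a
    simp only [hR, hq]
    -- `GL`-typed copies, so that the homomorphism lemmas apply
    set a' : GL (Fin m) (AdeleRing (𝓞 K) K) := ((a : (AdelicGroupData.gl m K).Adelic)) with ha'
    set g' : GL (Fin m) (AdeleRing (𝓞 K) K) := g with hg'
    have hea : Real.exp (centerLog m K hm a) = (((glAbsDet m K a' : ℝ≥0ˣ) : ℝ≥0) : ℝ) := exp_centerLog hm a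
    have hdet : (((glAbsDet m K (a'⁻¹ * g'⁻¹) : ℝ≥0ˣ) : ℝ≥0) : ℝ) = Real.exp (-(centerLog m K hm a) + L) := by
      rw [map_mul, map_inv, Units.val_mul, Units.val_inv_eq_inv_val, NNReal.coe_mul, NNReal.coe_inv,
        ← hea, ← Real.exp_neg, ← hN₀, ← Real.exp_log hN₀0, ← hL, ← Real.exp_add]
    change ENNReal.ofReal (r (((glAbsDet m K (a'⁻¹ * g'⁻¹) : ℝ≥0ˣ) : ℝ≥0) : ℝ)) ≤
      ENNReal.ofReal (Real.exp (-|-(centerLog m K hm a) + L|))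
    rw [hdet, hr]
    exact ENNReal.ofReal_le_ofReal min_rpow_mul_rpow_exp_le
  have hshift : ∫⁻ v : ℝ, q (-v + L) = ∫⁻ v : ℝ, q v := by
    have h1 : ∫⁻ v : ℝ, q (-v + L) = ∫⁻ v : ℝ, (fun w => q (-w)) (v + -L) := by
      refine lintegral_congr fun v => ?_
      simp only [neg_add_rev, neg_neg]
      ring_nf
    rw [h1, lintegral_add_right_eq_self (μ := (volume : Measure ℝ)) (fun w => q (-w)) (-L)]
    exact lintegral_neg_eq_self (μ := (volume : Measure ℝ)) q |> fun h => by simpa using h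
  calc (κ : ℝ≥0∞) * ∫⁻ a, R (((a : (AdelicGroupData.gl m K).Adelic))⁻¹ * g⁻¹) ∂α
      ≤ κ * ∫⁻ a, (fun v : ℝ => q (-v + L)) (centerLog m K hm a) ∂α :=
        mul_le_mul_right (lintegral_mono hpt) _
    _ = κ * (c * ∫⁻ v : ℝ, q (-v + L)) := by
        congr 1
        exact lintegral_comp_centerLog_eq_mul hm hα (fun v => q (-v + L))
    _ = κ * (c * ∫⁻ v : ℝ, q v) := by rw [hshift]

/-- **Absolute convergence of the unfolded integrand on the group.** For `0 < m < n`, continuous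
rapidly decreasing `Φ = invQuot φ`, `Φ' = invQuot φ'`, a `GL_m(K)`-covering weight `β`, any Haar
measure `ν` on `GL_m(𝔸_K)` and every `s ∈ ℂ`, the function
`y ↦ Φ(diag(y⁻¹,1)) |det y⁻¹|^{s-1/2} β(y⁻¹) Φ'(y⁻¹)` is `ν`-integrable: by the uniform decay
estimate (`exists_bound_corner_mul`) it is dominated by `C₀ R(y⁻¹) β(y⁻¹)` with the radial majorant
`R` of `fiberLIntegral_radial_mul_coveringWeight_le`, whose integral over the group is, by Weil's
formula on the finite-volume quotient `X_m` (`lintegral_fiberLIntegral_mul_eq_automorphic`), finite.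
[cite: CogdellAnalyticTheory2004, §2.2 (PDF p. 182)] -/
theorem integrable_fibre_integrand (hm : 0 < m) (hmn : m < n)
    (μ' : Measure (AdelicGroupData.gl m K).automorphicQuotient)
    [(AdelicGroupData.gl m K).IsAutomorphicMeasure μ']
    (ν : Measure (AdelicGroupData.gl m K).Adelic) [ν.IsHaarMeasure]
    {φ : (AdelicGroupData.gl n K).automorphicQuotient → ℂ}
    (hφc : Continuous (invQuot (AdelicGroupData.gl n K) φ))
    (hφd : IsRapidlyDecreasingGL n K (invQuot (AdelicGroupData.gl n K) φ))
    {φ' : (AdelicGroupData.gl m K).automorphicQuotient → ℂ}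
    (hφ'c : Continuous (invQuot (AdelicGroupData.gl m K) φ'))
    (hφ'd : IsRapidlyDecreasingGL m K (invQuot (AdelicGroupData.gl m K) φ'))
    {β : (AdelicGroupData.gl m K).Adelic → ℝ≥0∞}
    (hβ : IsCoveringWeight ↥(AdelicGroupData.gl m K).arithmeticSubgroup β) (s : ℂ) :
    Integrable (fun y : (AdelicGroupData.gl m K).Adelic =>
      invQuot (AdelicGroupData.gl n K) φ (glCorner (AdeleRing (𝓞 K) K) hmn.le (y⁻¹ : (AdelicGroupData.gl m K).Adelic)) *
        ((((glAbsDet m K (y⁻¹ : (AdelicGroupData.gl m K).Adelic) : ℝ≥0ˣ) : ℝ≥0) : ℝ) : ℂ) ^ (s - 1 / 2) *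
        ((β y⁻¹).toReal : ℂ) * invQuot (AdelicGroupData.gl m K) φ' y⁻¹) ν := by
  haveI : ν.IsInvInvariant := isInvInvariant_of_isHaarMeasure_gl (n := m) (K := K) ν
  haveI : BorelSpace ↥(AdelicGroupData.gl m K).center' := Subtype.borelSpace _
  haveI : BorelSpace ↥(AdelicGroupData.gl m K).quotientSubgroup := Subtype.borelSpace _
  set Φ : (AdelicGroupData.gl n K).Adelic → ℂ := invQuot (AdelicGroupData.gl n K) φ with hΦ
  set Φ' : (AdelicGroupData.gl m K).Adelic → ℂ := invQuot (AdelicGroupData.gl m K) φ' with hΦ'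
  have hK : ∀ γ ∈ rationalPointsGL n K, ∀ g : GL (Fin n) (AdeleRing (𝓞 K) K), Φ (γ * g) = Φ g :=
    fun γ hγ g => isLeftInvariant_invQuot _ φ γ hγ g
  have hZ : ∀ z ∈ (posRealScalar n K).range, ∀ g : GL (Fin n) (AdeleRing (𝓞 K) K), Φ (z * g) = Φ g :=
    fun z hz g => invQuot_mul_left _ φ (Subgroup.mem_sup_left hz) g
  have hK' : ∀ γ ∈ rationalPointsGL m K, ∀ g : GL (Fin m) (AdeleRing (𝓞 K) K), Φ' (γ * g) = Φ' g :=
    fun γ hγ g => isLeftInvariant_invQuot _ φ' γ hγ g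
  have hZ' : ∀ z ∈ (posRealScalar m K).range, ∀ g : GL (Fin m) (AdeleRing (𝓞 K) K), Φ' (z * g) = Φ' g :=
    fun z hz g => invQuot_mul_left _ φ' (Subgroup.mem_sup_left hz) g
  obtain ⟨M, -, hM⟩ := exists_bound_of_isRapidlyDecreasingGL hφc hK hZ hφd
  obtain ⟨M', -, hM'⟩ := exists_bound_of_isRapidlyDecreasingGL hφ'c hK' hZ' hφ'd
  set σ' : ℝ := s.re - 1 / 2 with hσ'
  set B : ℝ := |σ'| + 1 with hB
  have hB0 : 0 < B := by positivity
  obtain ⟨C₀, hC₀0, hC₀⟩ := exists_bound_corner_mul hK hZ hφd hM hK' hZ' hφ'd hM' hm hmn hB0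
  -- the radial majorant
  set r : ℝ → ℝ := fun t => min (t ^ B) (t ^ (-B)) * t ^ σ' with hr
  set R : (AdelicGroupData.gl m K).Adelic → ℝ≥0∞ := fun y =>
    ENNReal.ofReal (r (((glAbsDet m K y : ℝ≥0ˣ) : ℝ≥0) : ℝ)) with hR
  have hNc : Continuous fun y : (AdelicGroupData.gl m K).Adelic => (((glAbsDet m K y : ℝ≥0ˣ) : ℝ≥0) : ℝ) :=
    continuous_glAbsDet_real m K
  have hNm : Measurable fun y : (AdelicGroupData.gl m K).Adelic => (((glAbsDet m K y : ℝ≥0ˣ) : ℝ≥0) : ℝ) :=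
    hNc.measurable
  have hrm : Measurable r :=
    (Measurable.min (measurable_id.pow_const _) (measurable_id.pow_const _)).mul (measurable_id.pow_const _)
  have hRm : Measurable R := ENNReal.measurable_ofReal.comp (hrm.comp hNm)
  -- measurability of the integrand
  have hfm := measurable_fibre_integrand hmn hφc hφ'c hβ.measurable s
  refine ⟨hfm.aestronglyMeasurable, ?_⟩
  -- pointwise domination `‖f y‖ₑ ≤ ofReal C₀ * (R y⁻¹ * β y⁻¹)` (stated at `x = y⁻¹`)
  have hdom : ∀ x : (AdelicGroupData.gl m K).Adelic,
      ‖Φ (glCorner (AdeleRing (𝓞 K) K) hmn.le x) *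
          ((((glAbsDet m K x : ℝ≥0ˣ) : ℝ≥0) : ℝ) : ℂ) ^ (s - 1 / 2) * ((β x).toReal : ℂ) * Φ' x‖ₑ ≤
        ENNReal.ofReal C₀ * (R x * β x) := by
    intro x
    have hβx : β x ≠ ∞ := ne_top_of_le_ne_top ENNReal.one_ne_top (hβ.le_one x)
    have hNpos : 0 < (((glAbsDet m K x : ℝ≥0ˣ) : ℝ≥0) : ℝ) := glAbsDet_real_pos _
    rw [← ofReal_norm, norm_mul, norm_mul, norm_mul,
      Complex.norm_cpow_eq_rpow_re_of_pos hNpos, Complex.norm_real, Real.norm_of_nonneg ENNReal.toReal_nonneg]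
    have hre : (s - 1 / 2).re = σ' := by rw [hσ']; simp
    rw [hre]
    have hude := hC₀ x
    set N : ℝ := (((glAbsDet m K x : ℝ≥0ˣ) : ℝ≥0) : ℝ) with hN
    have hr0 : 0 ≤ r N := by
      rw [hr]
      exact mul_nonneg (le_min (Real.rpow_nonneg hNpos.le _) (Real.rpow_nonneg hNpos.le _))
        (Real.rpow_nonneg hNpos.le _)
    have hRx : R x = ENNReal.ofReal (r N) := by rw [hR]
    rw [hRx]
    conv_rhs => rw [← ENNReal.ofReal_toReal hβx, ← ENNReal.ofReal_mul hr0, ← ENNReal.ofReal_mul hC₀0]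
    refine ENNReal.ofReal_le_ofReal ?_
    have h0 : 0 ≤ N ^ σ' := Real.rpow_nonneg hNpos.le _
    calc ‖Φ (glCorner (AdeleRing (𝓞 K) K) hmn.le x)‖ * N ^ σ' * (β x).toReal * ‖Φ' x‖
        = (‖Φ (glCorner (AdeleRing (𝓞 K) K) hmn.le x)‖ * ‖Φ' x‖) * (N ^ σ' * (β x).toReal) := by ring
      _ ≤ (C₀ * min (N ^ B) (N ^ (-B))) * (N ^ σ' * (β x).toReal) :=
          mul_le_mul_of_nonneg_right hude (by positivity)
      _ = C₀ * (r N * (β x).toReal) := by simp only [hr]; ring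
  -- the majorant has finite integral: Weil's formula on the finite-volume quotient
  have hmaj_meas : Measurable fun y : (AdelicGroupData.gl m K).Adelic => R y⁻¹ * β y⁻¹ :=
    (hRm.comp measurable_inv).mul (hβ.measurable.comp measurable_inv)
  -- Haar measures on `A_G` and `H`, and their comparison constants
  set α : Measure ↥(AdelicGroupData.gl m K).center' := Measure.haar with hαdef
  obtain ⟨c, hc, hα⟩ := exists_map_centerLog_eq_smul_volume hm α
  obtain ⟨κ, hκ, hκeq⟩ := exists_map_quotientSubgroupEquiv_eq_smul_prod (quotientSubgroupHaar m K) α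
  set I₁ : ℝ≥0∞ := ∫⁻ v : ℝ, ENNReal.ofReal (Real.exp (-|v|)) with hI₁
  have hI₁ : I₁ < ∞ := by
    have h := (integrable_exp_neg_mul_abs_real one_pos).lintegral_lt_top
    simpa [neg_mul, one_mul] using h
  -- fibre integrals bounded by `κ c I₁`
  have hfib : ∀ x : (AdelicGroupData.gl m K).automorphicQuotient,
      fiberLIntegral (AdelicGroupData.gl m K).quotientSubgroup (quotientSubgroupHaar m K)
        (fun y : (AdelicGroupData.gl m K).Adelic => R y⁻¹ * β y⁻¹) x ≤ κ * (c * I₁) := by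
    intro x
    induction x using QuotientGroup.induction_on with
    | H g =>
      rw [fiberLIntegral_mk]
      exact fiberLIntegral_radial_mul_coveringWeight_le hm hβ hκeq hα σ' g
  have hweil := lintegral_fiberLIntegral_mul_eq_automorphic m K μ' ν hmaj_meas
    (F := fun _ => (1 : ℝ≥0∞)) measurable_const
  simp only [mul_one] at hweil
  have hCW := automorphicUnfoldingConstant_pos m K μ' ν
  have hfin : ∫⁻ y, R y⁻¹ * β y⁻¹ ∂ν < ∞ := by
    have h1 : (automorphicUnfoldingConstant m K μ' ν : ℝ≥0∞) * ∫⁻ y, R y⁻¹ * β y⁻¹ ∂ν ≤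
        ∫⁻ _x, κ * (c * I₁) ∂μ' := by
      rw [← hweil]
      exact lintegral_mono hfib
    rw [lintegral_const] at h1
    have h2 : (κ : ℝ≥0∞) * (c * I₁) * μ' Set.univ < ∞ :=
      ENNReal.mul_lt_top (ENNReal.mul_lt_top ENNReal.coe_lt_top (ENNReal.mul_lt_top ENNReal.coe_lt_top hI₁))
        (measure_lt_top μ' _)
    have h3 : (automorphicUnfoldingConstant m K μ' ν : ℝ≥0∞) ≠ 0 := by exact_mod_cast hCW.ne'
    have h4 : ∫⁻ y, R y⁻¹ * β y⁻¹ ∂ν ≤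
        ((κ : ℝ≥0∞) * (c * I₁) * μ' Set.univ) / (automorphicUnfoldingConstant m K μ' ν : ℝ≥0∞) := by
      rw [ENNReal.le_div_iff_mul_le (Or.inl h3) (Or.inl ENNReal.coe_ne_top), mul_comm]
      exact h1
    exact lt_of_le_of_lt h4 (ENNReal.div_lt_top h2.ne h3)
  calc ∫⁻ y : (AdelicGroupData.gl m K).Adelic, ‖Φ (glCorner (AdeleRing (𝓞 K) K) hmn.le (y⁻¹ : (AdelicGroupData.gl m K).Adelic)) *
        ((((glAbsDet m K (y⁻¹ : (AdelicGroupData.gl m K).Adelic) : ℝ≥0ˣ) : ℝ≥0) : ℝ) : ℂ) ^ (s - 1 / 2) *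
        ((β y⁻¹).toReal : ℂ) * Φ' y⁻¹‖ₑ ∂ν
      ≤ ∫⁻ y : (AdelicGroupData.gl m K).Adelic, ENNReal.ofReal C₀ * (R y⁻¹ * β y⁻¹) ∂ν :=
        lintegral_mono fun y => hdom y⁻¹
    _ = ENNReal.ofReal C₀ * ∫⁻ y, R y⁻¹ * β y⁻¹ ∂ν := lintegral_const_mul _ hmaj_meas
    _ < ∞ := ENNReal.mul_lt_top ENNReal.ofReal_lt_top hfin

end Integrable

/-! ### The unfolding from the quotient to the group -/

section Main

variable {n m : ℕ} {K : Type} [Field K] [NumberField K]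

attribute [local instance] measurableSpaceQuotient borelSpaceQuotient smulInvariantMeasureQuotient
  isFiniteMeasureOnCompactsQuotient

/-- **`I(s; φ, φ')` as an integral over `GL_m(𝔸_K)` against a `GL_m(K)`-covering weight**
(Cogdell (2004), §2.2: `I(s; φ, φ') = ∫_{GL_m(K)\GL_m(𝔸)} φ(diag(h,1)) φ'(h) |det h|^{s-1/2} dh`, the
quotient by the discrete group realised by a weight `β` with `Σ_{γ ∈ GL_m(K)} β(γ g) = 1`; Weil's
formula, Getz–Hahn (2024), Thm. 3.2.2). For `0 < m < n`, an automorphic measure `μ'` on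
`X_m = GL_m(𝔸_K) ⧸ A_G GL_m(K)` and a Haar measure `ν` on `GL_m(𝔸_K)` there is `C > 0` (depending
only on these) such that for all continuous `φ` on `X_n`, `φ'` on `X_m` with rapidly decreasing
classical functions `Φ = invQuot φ`, `Φ' = invQuot φ'`, every `GL_m(K)`-covering weight `β` and every
`s ∈ ℂ`: the function `g ↦ Φ(diag(g,1)) Φ'(g) |det g|_𝔸^{s-1/2} β(g)` is `ν`-integrable and

  `jpssIntegral hmn μ' φ φ' s = C ∫_{GL_m(𝔸_K)} Φ(diag(g,1)) Φ'(g) |det g|_𝔸^{s-1/2} β(g) dν(g)`.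

[cite: CogdellAnalyticTheory2004, §2.2 (PDF pp. 181–182)] -/
theorem exists_jpssIntegral_eq_mul_integral_coveringWeight (hm : 0 < m) (hmn : m < n)
    (μ' : Measure (AdelicGroupData.gl m K).automorphicQuotient)
    [(AdelicGroupData.gl m K).IsAutomorphicMeasure μ']
    (ν : Measure (AdelicGroupData.gl m K).Adelic) [ν.IsHaarMeasure] :
    ∃ C : ℝ, 0 < C ∧
      ∀ (φ : (AdelicGroupData.gl n K).automorphicQuotient → ℂ),
        Continuous (invQuot (AdelicGroupData.gl n K) φ) →
        IsRapidlyDecreasingGL n K (invQuot (AdelicGroupData.gl n K) φ) →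
      ∀ (φ' : (AdelicGroupData.gl m K).automorphicQuotient → ℂ),
        Continuous (invQuot (AdelicGroupData.gl m K) φ') →
        IsRapidlyDecreasingGL m K (invQuot (AdelicGroupData.gl m K) φ') →
      ∀ (β : (AdelicGroupData.gl m K).Adelic → ℝ≥0∞),
        IsCoveringWeight ↥(AdelicGroupData.gl m K).arithmeticSubgroup β →
      ∀ s : ℂ,
        Integrable (fun g : (AdelicGroupData.gl m K).Adelic =>
          invQuot (AdelicGroupData.gl n K) φ (glCorner (AdeleRing (𝓞 K) K) hmn.le g) *
            invQuot (AdelicGroupData.gl m K) φ' g *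
            ((((glAbsDet m K g : ℝ≥0ˣ) : ℝ≥0) : ℝ) : ℂ) ^ (s - 1 / 2) * ((β g).toReal : ℂ)) ν ∧
        jpssIntegral hmn μ' φ φ' s =
          (C : ℂ) * ∫ g : (AdelicGroupData.gl m K).Adelic,
            invQuot (AdelicGroupData.gl n K) φ (glCorner (AdeleRing (𝓞 K) K) hmn.le g) *
              invQuot (AdelicGroupData.gl m K) φ' g *
              ((((glAbsDet m K g : ℝ≥0ˣ) : ℝ≥0) : ℝ) : ℂ) ^ (s - 1 / 2) * ((β g).toReal : ℂ) ∂ν := by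
  haveI : ν.IsInvInvariant := isInvInvariant_of_isHaarMeasure_gl (n := m) (K := K) ν
  haveI : BorelSpace ↥(AdelicGroupData.gl m K).center' := Subtype.borelSpace _
  haveI : BorelSpace ↥(AdelicGroupData.gl m K).quotientSubgroup := Subtype.borelSpace _
  -- Haar measures on `A_G` and on `H = A_G GL_m(K)`, and the constants
  set α : Measure ↥(AdelicGroupData.gl m K).center' := Measure.haar with hαdef
  obtain ⟨c, hc, hα⟩ := exists_map_centerLog_eq_smul_volume hm α
  obtain ⟨κ, hκ, hκeq⟩ := exists_map_quotientSubgroupEquiv_eq_smul_prod (quotientSubgroupHaar m K) α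
  set D : ℕ := m * Module.finrank ℚ K with hD
  have hD0 : 0 < D := Nat.mul_pos hm Module.finrank_pos
  have hD0r : (0 : ℝ) < D := by exact_mod_cast hD0
  have hCW := automorphicUnfoldingConstant_pos m K μ' ν
  have hCpos : (0 : ℝ) < (automorphicUnfoldingConstant m K μ' ν : ℝ) / (κ * c * D) :=
    div_pos (NNReal.coe_pos.2 hCW) (mul_pos (mul_pos (NNReal.coe_pos.2 hκ) (NNReal.coe_pos.2 hc)) hD0r)
  refine ⟨(automorphicUnfoldingConstant m K μ' ν : ℝ) / (κ * c * D), hCpos,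
    fun φ hφc hφd φ' hφ'c hφ'd β hβ s => ?_⟩
  set Φ : (AdelicGroupData.gl n K).Adelic → ℂ := invQuot (AdelicGroupData.gl n K) φ with hΦ
  set Φ' : (AdelicGroupData.gl m K).Adelic → ℂ := invQuot (AdelicGroupData.gl m K) φ' with hΦ'
  -- Weil's integrand on the group
  set f : (AdelicGroupData.gl m K).Adelic → ℂ := fun y =>
    Φ (glCorner (AdeleRing (𝓞 K) K) hmn.le (y⁻¹ : (AdelicGroupData.gl m K).Adelic)) *
      ((((glAbsDet m K (y⁻¹ : (AdelicGroupData.gl m K).Adelic) : ℝ≥0ˣ) : ℝ≥0) : ℝ) : ℂ) ^ (s - 1 / 2) *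
      ((β y⁻¹).toReal : ℂ) * Φ' y⁻¹ with hf
  have hf_int : Integrable f ν := integrable_fibre_integrand hm hmn μ' ν hφc hφd hφ'c hφ'd hβ s
  have hf_meas : Measurable f := measurable_fibre_integrand hmn hφc hφ'c hβ.measurable s
  have hJ : (fun g : (AdelicGroupData.gl m K).Adelic =>
      Φ (glCorner (AdeleRing (𝓞 K) K) hmn.le g) * Φ' g *
        ((((glAbsDet m K g : ℝ≥0ˣ) : ℝ≥0) : ℝ) : ℂ) ^ (s - 1 / 2) * ((β g).toReal : ℂ)) = fun g => f g⁻¹ := by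
    funext g
    simp only [hf, inv_inv]
    ring
  refine ⟨by rw [hJ]; exact hf_int.comp_inv, ?_⟩
  -- Weil's formula for `f`
  have hweil := integral_fiberIntegralE_eq_mul_integral (AdelicGroupData.gl m K).quotientSubgroup
    (quotientSubgroupHaar m K) μ' ν hf_meas hf_int
  -- the constant of the fibre computation
  set k₀ : ℂ := (κ : ℂ) * (((c : ℝ) * (m * Module.finrank ℚ K : ℕ) : ℂ)) with hk₀
  -- the fibre integral of `f` is `k₀ · φ' · jpssFibre`, a.e.
  have hfibre : ∀ᵐ x ∂μ', fiberIntegralE (AdelicGroupData.gl m K).quotientSubgroup (quotientSubgroupHaar m K) f x =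
      k₀ * (φ' x * jpssFibre hmn φ s x) := by
    filter_upwards [ae_integrable_fiber_of_integrable (AdelicGroupData.gl m K).quotientSubgroup
      (quotientSubgroupHaar m K) μ' ν hf_meas hf_int] with x hx
    induction x using QuotientGroup.induction_on with
    | H g =>
      have hint_g : Integrable (fun h : ↥(AdelicGroupData.gl m K).quotientSubgroup =>
          f (g * (h : (AdelicGroupData.gl m K).Adelic))) (quotientSubgroupHaar m K) := hx g rfl
      obtain ⟨-, -, hI⟩ := integral_quotientSubgroup_eq_smul_integral_tsum hκeq hint_g
      rw [fiberIntegralE_mk, hI]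
      have hts : ∀ a : ↥(AdelicGroupData.gl m K).center',
          ∑' γ : ↥(AdelicGroupData.gl m K).arithmeticSubgroup,
            f (g * (((quotientSubgroupEquiv m K).symm (a, γ) : ↥(AdelicGroupData.gl m K).quotientSubgroup) :
              (AdelicGroupData.gl m K).Adelic)) =
          Φ' g⁻¹ * (Φ (glCorner (AdeleRing (𝓞 K) K) hmn.le
              (((a : (AdelicGroupData.gl m K).Adelic))⁻¹ * g⁻¹)) *
            ((((glAbsDet m K (((a : (AdelicGroupData.gl m K).Adelic))⁻¹ * g⁻¹) : ℝ≥0ˣ) : ℝ≥0) : ℝ) : ℂ) ^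
              (s - 1 / 2)) := by
        intro a
        simp only [coe_quotientSubgroupEquiv_symm_apply, hf]
        exact tsum_fibre_integrand_eq hmn φ φ' hβ s g a
      simp_rw [hts]
      rw [integral_const_mul, integral_center'_fibre_eq_mul_jpssKernel hm hmn φ hα s g]
      have hφ'g : Φ' g⁻¹ = φ' (QuotientGroup.mk g) := by
        have h := invQuot_apply (AdelicGroupData.gl m K) φ' g⁻¹
        rw [inv_inv] at h
        exact h
      rw [hφ'g, Complex.real_smul]
      change (((κ : ℝ≥0) : ℝ) : ℂ) * (φ' (QuotientGroup.mk g) *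
          ((((c : ℝ) * (m * Module.finrank ℚ K : ℕ) : ℂ)) * jpssKernel hmn φ s g⁻¹)) =
        k₀ * (φ' (QuotientGroup.mk g) * jpssKernel hmn φ s g⁻¹)
      rw [hk₀]
      ring
  -- assemble
  have h1 : ∫ x, fiberIntegralE (AdelicGroupData.gl m K).quotientSubgroup (quotientSubgroupHaar m K) f x ∂μ' =
      k₀ * jpssIntegral hmn μ' φ φ' s := by
    refine (integral_congr_ae hfibre).trans ?_
    rw [integral_const_mul]
    rfl
  have h2 : ∫ g, f g ∂ν = ∫ g : (AdelicGroupData.gl m K).Adelic,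
      Φ (glCorner (AdeleRing (𝓞 K) K) hmn.le g) * Φ' g *
        ((((glAbsDet m K g : ℝ≥0ˣ) : ℝ≥0) : ℝ) : ℂ) ^ (s - 1 / 2) * ((β g).toReal : ℂ) ∂ν := by
    rw [hJ]
    exact (integral_inv_eq_self f ν).symm
  have key : k₀ * jpssIntegral hmn μ' φ φ' s =
      (unfoldingConstant (AdelicGroupData.gl m K).quotientSubgroup (quotientSubgroupHaar m K) μ' ν : ℂ) *
        ∫ g : (AdelicGroupData.gl m K).Adelic,
          Φ (glCorner (AdeleRing (𝓞 K) K) hmn.le g) * Φ' g *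
            ((((glAbsDet m K g : ℝ≥0ˣ) : ℝ≥0) : ℝ) : ℂ) ^ (s - 1 / 2) * ((β g).toReal : ℂ) ∂ν := by
    rw [← h1, ← h2]
    exact hweil
  have hk₀' : k₀ = (((κ : ℝ) * c * D : ℝ) : ℂ) := by
    rw [hk₀, hD]; push_cast; ring
  have hk₀0 : k₀ ≠ 0 := by
    rw [hk₀']
    have h : (0 : ℝ) < κ * c * D := mul_pos (mul_pos (NNReal.coe_pos.2 hκ) (NNReal.coe_pos.2 hc)) hD0r
    exact_mod_cast h.ne'
  have hgoal : jpssIntegral hmn μ' φ φ' s = k₀⁻¹ *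
      ((unfoldingConstant (AdelicGroupData.gl m K).quotientSubgroup (quotientSubgroupHaar m K) μ' ν : ℂ) *
        ∫ g : (AdelicGroupData.gl m K).Adelic,
        Φ (glCorner (AdeleRing (𝓞 K) K) hmn.le g) * Φ' g *
          ((((glAbsDet m K g : ℝ≥0ˣ) : ℝ≥0) : ℝ) : ℂ) ^ (s - 1 / 2) * ((β g).toReal : ℂ) ∂ν) := by
    rw [← key, ← mul_assoc, inv_mul_cancel₀ hk₀0, one_mul]
  have hCWeq : (automorphicUnfoldingConstant m K μ' ν : ℝ) =
      (unfoldingConstant (AdelicGroupData.gl m K).quotientSubgroup (quotientSubgroupHaar m K) μ' ν : ℝ) := rfl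
  rw [hgoal, ← mul_assoc, hCWeq]
  congr 1
  rw [hk₀']
  have h1' : (κ : ℝ) ≠ 0 := (NNReal.coe_pos.2 hκ).ne'
  have h2' : (c : ℝ) ≠ 0 := (NNReal.coe_pos.2 hc).ne'
  have h3' : (D : ℝ) ≠ 0 := hD0r.ne'
  have h4' : ((κ : ℝ) : ℂ) ≠ 0 := by exact_mod_cast h1'
  have h5' : ((c : ℝ) : ℂ) ≠ 0 := by exact_mod_cast h2'
  have h6' : ((D : ℝ) : ℂ) ≠ 0 := by exact_mod_cast h3'
  push_cast
  field_simp

end Main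

end Literature.NumberTheory.Automorphic
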